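import Summits.CriticalPhenomena.Ising3D.Control2DL15TwoSided0975
import Summits.CriticalPhenomena.Ising3D.Control2DL19BoxV
import Summits.CriticalPhenomena.Ising3D.Control2DL19GapC
import Mathlib.Tactic.NormNum
import HarnessLib

/-!
# Λ = 19 on both sides in the kernel: `0.98 < Δ_ε < 1.00005` at `Δ_σ = 1/8` under `A2D′`, no window
(cell `pub-ising3x`, seat controls-1 gen 19; KERNEL PATH for the 2D γ-certificates, Λ ≤ 19 class-1 cover — CONTROL-ONLY)

HONEST FRAMING: lottery ticket; floor = tightest certified 3D Ising CFT bounds; no exact-solution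
claim without a proof. CONTROL-ONLY (`d = 2`, `Δ_σ = 1/8`, axiom set `A2D′`); nothing about `d = 3`; still weaker
than the reader-certified statement of record (`0.99 < Δ_ε < 1.00005`, Λ = 19, readers A ∧ B) on the lower side.

The RB-5 Λ = 19 / E₀ = 48 box certificate `j135119` (`[39/40, 49/50]`; truncation `Nd = 79` at spin 0 — the first
`Nd = 79` cell data in the kernel, its oversized literals split `lo ++ hi` over two files — `71` at spins 2–8, `63`
at 10–14, `55` at 16, `47` at 18–46; `Control2DL19BoxV`) appended to the Λ = 15 box cover
`excludedOn_2d_cover0975`, with the Λ = 19 gap certificate `gapExcluded_2d_L19_gapC` on top: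
* `excludedOn_2d_cover098 : ExcludedOn (1/8) 2 1 (Icc 0 (49/50))`;
* `twoSided_2d_kernel098 (w) : TwoSided (1/8) 2 1 w (49/50) (20001/20000)` for EVERY real `w` — under `A2D′` at
  `Δ_σ = 1/8`: `0.98 < Δ_ε < 1.00005` (2D Ising: `Δ_ε = 1`) = the reader-certified RB-5 statement (`cover_v13.json`)
  now resting on the Lean kernel alone. No facts, standard axioms only.
-/

namespace Summit.CriticalPhenomena.Ising3D.Control2D

open Set
open Literature.MathematicalPhysics.QuantumFieldTheory.ConformalBootstrap3D

/-- **Kernel-complete cover of the `ε` locations `[0, 49/50]`** at `Δ_σ = 1/8` under `A2D′` (Λ = 19 box V appended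
to the Λ ≤ 15 cover). CONTROL-ONLY (d = 2). [cite: RattazziEtAl2008, §5.5] -/
theorem excludedOn_2d_cover098 : ExcludedOn (1 / 8 : ℝ) 2 1 (Icc (0 : ℝ) (49 / 50)) :=
  excludedOn_Icc_append excludedOn_2d_cover0975 excludedOn_2d_L19_boxV le_rfl

/-- **2D control, class 1, kernel-complete, Λ = 19 on both sides — for EVERY window parameter `w`**: under `A2D′`
at `Δ_σ = 1/8` the `ε` location satisfies `49/50 < Δ_ε < 20001/20000`. CONTROL-ONLY (d = 2).
[cite: RattazziEtAl2008, §5.5] -/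
theorem twoSided_2d_kernel098 (w : ℝ) : TwoSided (1 / 8 : ℝ) 2 1 w (49 / 50) (20001 / 20000) :=
  twoSided_of_cover_zero excludedOn_2d_cover098 gapExcluded_2d_L19_gapC (by norm_num) w

end Summit.CriticalPhenomena.Ising3D.Control2D
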